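import Literature.NumberTheory.EllipticCurves.GreenbergVatsal2000.ResidualSelmerGroups
import HarnessLib

/-!
# Naturality of `pushH1` for the crux `SignedTransportAtTwo` (stmt-BirchSwinnertonDyer-20333, route `ThetaPartnerAtTwo`,
# line `bridge` v9): change of coefficients on `H¹(H, ·)` commutes with conjugation and with the inertia / archimedean
# restrictions, hence preserves `unramifiedKer`, `unramifiedOutside` and `infKer`
# (lead prover bsd-wall-tp2-p1 g4; `--supports stmt-BirchSwinnertonDyer-20333`; route-independent, closes nothing)

HONEST FRAMING. THEOREMS ONLY (no definition); nothing about any curve is asserted; BSD is not proved by any of this.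
No import of any route file.

WHAT. Line `bridge` v9 splits the algebraic `μ`-stub of the crux along the Greenberg–Vatsal / B. D. Kim residual
devissage (GV Invent. Math. 142 (2000) §2 p. 28, Prop. (2.8); Kim, Asian J. Math. 13 (2009) Prop. 2.9–2.10): the residual
Selmer-type groups of `W[2]` and `A[2]` over `ℚ_∞` are compared along the bijection
`ẽ_* = pushH1 H ẽ : H¹(H, W[2^∞][2]) → H¹(H, A[2^∞][2])` of p537955. The composition needs that `ẽ_*` carries the
TRANSPORTABLE local conditions of one side to the other; this file proves it for Mathlib's continuous cohomology
(`Literature.NumberTheory.EllipticCurves.resH1Hom`, functoriality `resH1Hom_comp` / `resH1Hom_congr`), for any number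
field `K`, any `H ≤ Γ_K`, any equivariant `i : M →+ M'` of discrete `Γ_K`-modules:

* `pushH1_conjH1` — `i_* ∘ conj_σ = conj_σ ∘ i_*` (`H` normal);
* `resH1Hom_id_pushH1_eq_zero` — for any continuous `θ : G' → H` compatible with the actions, `res_θ c = 0 ⇒ res_θ (i_* c) = 0`
  (`res_θ ∘ i_* = (θ, i)_* = i_* ∘ res_θ`);
* `pushH1_mem_unramifiedKer`, `pushH1_mem_unramifiedOutside` (GV's `H¹(ℚ_Σ/ℚ_∞, ·)`, file
  `GreenbergVatsal2000/GreenbergSelmerGroups`), `pushH1_mem_infKer` (Greenberg's archimedean condition, file `GreenbergSelmer`).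

References: [SerreGaloisCohomology1997] I.§2.4–2.5 (functoriality of `H¹` in compatible pairs; conjugation);
[GreenbergVatsal2000] §2 p. 28; [BDKim2009] Prop. 2.9.
-/

set_option autoImplicit false
-- D-0017: single-problem summit, so `Summit.BirchSwinnertonDyer.BirchSwinnertonDyer.…` repeats a namespace BY DESIGN.
set_option linter.dupNamespace false

noncomputable section

open scoped Classical AddSubgroup

open NumberField IsDedekindDomain Literature Literature.NumberTheory.EllipticCurves Literature.NumberTheory.GaloisRepresentations
  Literature.NumberTheory.EllipticCurves.GreenbergVatsal2000

namespace Summit.BirchSwinnertonDyer.BirchSwinnertonDyer.Theorems.SignedTransportAtTwo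

universe u

section Naturality

variable {K : Type u} [Field K] [NumberField K] (H : Subgroup (Field.absoluteGaloisGroup K)) [H.Normal]
variable {M : Type u} [AddCommGroup M] [DistribMulAction (Field.absoluteGaloisGroup K) M]
  [TopologicalSpace M] [DiscreteTopology M]
variable {M' : Type u} [AddCommGroup M'] [DistribMulAction (Field.absoluteGaloisGroup K) M']
  [TopologicalSpace M'] [DiscreteTopology M']
variable (i : M →+ M') (hi : ∀ (g : Field.absoluteGaloisGroup K) (x : M), i (g • x) = g • i x)

omit [NumberField K] in
/-- **`pushH1` commutes with the conjugation action**: `i_* (conj_σ c) = conj_σ (i_* c)` — both are the map of the compatible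
pair `(h ↦ σ⁻¹hσ, m ↦ i(σ m) = σ i(m))`. Serre, *Galois Cohomology*, I.§2.5. [cite: SerreGaloisCohomology1997, I.§2.4 and I.§2.5] -/
theorem pushH1_conjH1 (σ : Field.absoluteGaloisGroup K) (c : subgroupH1 H M) :
    pushH1 H i hi (Literature.NumberTheory.EllipticCurves.conjH1 H M σ c) =
      Literature.NumberTheory.EllipticCurves.conjH1 H M' σ (pushH1 H i hi c) := by
  have h1 := resH1Hom_comp (subgroupConj H σ) (DistribSMul.toAddMonoidHom M σ)
    (fun x m ↦ by
      simp only [DistribSMul.toAddMonoidHom_apply, Subgroup.smul_def, subgroupConj_apply_coe,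
        smul_smul, mul_assoc, mul_inv_cancel_left])
    (ContinuousMonoidHom.id H) i (fun h x ↦ hi h x)
  have h2 := resH1Hom_comp (ContinuousMonoidHom.id H) i (fun h x ↦ hi h x)
    (subgroupConj H σ) (DistribSMul.toAddMonoidHom M' σ)
    (fun x m ↦ by
      simp only [DistribSMul.toAddMonoidHom_apply, Subgroup.smul_def, subgroupConj_apply_coe,
        smul_smul, mul_assoc, mul_inv_cancel_left])
  have e1 := DFunLike.congr_fun h1 c
  have e2 := DFunLike.congr_fun h2 c
  simp only [AddMonoidHom.coe_comp, Function.comp_apply] at e1 e2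
  change (resH1Hom (ContinuousMonoidHom.id H) i _) (resH1Hom (subgroupConj H σ) _ _ c) =
    (resH1Hom (subgroupConj H σ) _ _) (resH1Hom (ContinuousMonoidHom.id H) i _ c)
  rw [e1, e2]
  refine DFunLike.congr_fun (resH1Hom_congr rfl ?_ _ _) c
  ext x
  simp [hi]

omit [NumberField K] [H.Normal] in
/-- **`i_*` preserves the kernel of any restriction** `res_θ : H¹(H, ·) → H¹(G', ·)` along a continuous `θ : G' → H`
compatible with the actions (identity coefficients): `res_θ c = 0 ⇒ res_θ (i_* c) = 0`, because
`res_θ ∘ i_* = (θ, i)_* = i_* ∘ res_θ`. Serre, *Galois Cohomology*, I.§2.4. [cite: SerreGaloisCohomology1997, I.§2.4 and I.§2.5] -/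
theorem resH1Hom_id_pushH1_eq_zero {G' : Type u} [Group G'] [TopologicalSpace G'] [IsTopologicalGroup G']
    [DistribMulAction G' M] [DistribMulAction G' M']
    (θ : G' →ₜ* H) (hθ : ∀ (x : G') (m : M), θ x • m = x • m) (hθ' : ∀ (x : G') (m' : M'), θ x • m' = x • m')
    (c : subgroupH1 H M)
    (hc : resH1Hom (N := M) θ (AddMonoidHom.id M) hθ c = 0) :
    resH1Hom (N := M') θ (AddMonoidHom.id M') hθ' (pushH1 H i hi c) = 0 := by
  have hiG' : ∀ (g : G') (x : M), i (g • x) = g • i x := fun g x ↦ by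
    rw [← hθ g x, ← hθ' g (i x)]; exact hi (θ g) x
  -- `res_θ ∘ i_* = (θ, i)_* = i_* ∘ res_θ`
  have h1 := resH1Hom_comp (ContinuousMonoidHom.id H) i (fun h x ↦ hi h x)
    θ (AddMonoidHom.id M') hθ'
  have h2 := resH1Hom_comp θ (AddMonoidHom.id M) hθ
    (ContinuousMonoidHom.id G') i hiG'
  have e1 := DFunLike.congr_fun h1 c
  have e2 := DFunLike.congr_fun h2 c
  simp only [AddMonoidHom.coe_comp, Function.comp_apply] at e1 e2
  change (resH1Hom θ (AddMonoidHom.id M') _) (resH1Hom (ContinuousMonoidHom.id H) i _ c) = 0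
  rw [e1]
  have e3 : resH1Hom ((ContinuousMonoidHom.id H).comp θ) ((AddMonoidHom.id M').comp i)
      (fun x m ↦ by
        change i (θ x • m) = x • i m
        rw [← hθ' x (i m)]
        exact hi (θ x) m) c =
      resH1Hom (θ.comp (ContinuousMonoidHom.id G')) (i.comp (AddMonoidHom.id M))
      (fun x m ↦ by
        change i (θ x • m) = x • i m
        rw [← hθ' x (i m)]
        exact hi (θ x) m) c :=
    DFunLike.congr_fun (resH1Hom_congr (by ext; rfl) (by ext; rfl) _ _) c
  rw [e3, ← e2]
  change (resH1Hom (ContinuousMonoidHom.id G') i _) (resH1Hom θ (AddMonoidHom.id M) _ c) = 0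
  rw [hc, map_zero]

omit [H.Normal] in
/-- **`i_*` preserves the unramified condition at a finite place `v`** (GV's `ker(H¹(ℚ_Σ/ℚ_∞, ·) → H¹(I_η, ·))`, p. 28:
the residual groups of display (16) are functorial in the coefficient module). [cite: GreenbergVatsal2000, §2 p. 28] -/
theorem pushH1_mem_unramifiedKer (v : HeightOneSpectrum (𝓞 K)) {c : subgroupH1 H M}
    (hc : c ∈ GreenbergVatsal2000.unramifiedKer H M v) :
    pushH1 H i hi c ∈ GreenbergVatsal2000.unramifiedKer H M' v :=
  resH1Hom_id_pushH1_eq_zero H i hi (GreenbergSelmer.inertiaInToH H v) (fun _ _ ↦ rfl) (fun _ _ ↦ rfl) c hc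

omit [NumberField K] [H.Normal] in
/-- **`i_*` preserves the archimedean condition** `infKer` (kernel of `H¹(H, ·) → H¹(H ⊓ D_w, ·)`, Greenberg 1989 (3)).
[cite: Greenberg1989, §1 p. 98 (3)] -/
theorem pushH1_mem_infKer (w : InfinitePlace K) {c : subgroupH1 H M}
    (hc : c ∈ GreenbergSelmer.infKer H M w) :
    pushH1 H i hi c ∈ GreenbergSelmer.infKer H M' w :=
  resH1Hom_id_pushH1_eq_zero H i hi
    (Literature.NumberTheory.EllipticCurves.subgroupInclusion
      (inf_le_left : H ⊓ GreenbergSelmer.decompInf w ≤ H)) (fun _ _ ↦ rfl) (fun _ _ ↦ rfl) c hc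

/-- **`i_*` preserves `H¹(ℚ_Σ/ℚ_∞, ·)`** (`unramifiedOutside`: unramified at every conjugate of every finite `v ∉ S₀`,
`v ∤ p`) — conjugation commutes with `i_*` and each `unramifiedKer` is preserved. GV p. 28 (functoriality of display (16) in
`Φ → E[p] → Ψ`); Kim Prop. 2.9 (transport along `E[p] ≅ E'[p]`). [cite: GreenbergVatsal2000, §2 p. 28] [cite: BDKim2009, Prop. 2.9] -/
theorem pushH1_mem_unramifiedOutside (p : ℕ) (S₀ : Set (HeightOneSpectrum (𝓞 K))) {c : subgroupH1 H M}
    (hc : c ∈ unramifiedOutside H M p S₀) :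
    pushH1 H i hi c ∈ unramifiedOutside H M' p S₀ := by
  rw [mem_unramifiedOutside_iff] at hc ⊢
  intro v hv hpv σ
  rw [← pushH1_conjH1 H i hi σ c]
  exact pushH1_mem_unramifiedKer H i hi v (hc v hv hpv σ)

end Naturality

end Summit.BirchSwinnertonDyer.BirchSwinnertonDyer.Theorems.SignedTransportAtTwo

end
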